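import Mathlib
import Literature.MathematicalPhysics.QuantumFieldTheory.LatticeGaugeProofs
import Literature.MathematicalPhysics.QuantumFieldTheory.TorusFreeTransfer
import Literature.MathematicalPhysics.QuantumFieldTheory.YangMillsOS
import HarnessLib

/-!
# Infinite-volume limit states along ODD tori and the plaquette-probe two-point function

Helper file for the support item `RPProbeCriticality` (route `EquipartitionCriticality` of
`YangMills`, item `stmt-QuantumFields-8763`): the compactness / transfer input of "device B".

* `exists_oddTorusLimit` — for a continuous representation `ρ` of a compact metrisable gauge
  group and every `β`, the torus Wilson states on the ODD tori `(ℤ/(2S+1)ℤ)^d` have a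
  subsequence `S_k` converging on bounded continuous cylinder observables to a probability
  measure `μ`, and `μ ∈ infiniteVolumeLimitPoints ρ β` (sizes `L_k + 1 = 2 S_k + 1`); the proof
  is the tree's `infiniteVolumeLimitPoints_nonempty_holds` (Riesz–Markov / Prokhorov compactness
  of `ProbabilityMeasure (G^{edges})`, Seiler LNP 159 Ch. 2, Chatterjee arXiv:1803.01950 §2) run
  on odd sizes only.
* Bridge identities between the `ℤ⁴` site probe `P(V) = ψ(V_{p₁₂(0)})` read on periodic
  configurations and Wave 0's torus plaquette holonomy (`probe_torusLift`,
  `probe_configShift_torusLift`), whence the torus connected correlation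
  `latticeConnectedCorr ρ β (2S+1) P P n` of `YangMillsOS` is the time-axis two-point function
  `⟨q₀ q_{n e₀}⟩ - ⟨q₀⟩²` of the torus site probe `q_x(U) = ψ(U_{p₁₂(x)})`
  (`latticeConnectedCorr_probe`).
* `tendsto_latticeConnectedCorr_probe` — along such a subsequence the torus connected
  correlations of the probe converge to the covariance
  `∫ P · P∘θ_{-n e₀} dμ - ∫ P dμ ∫ P∘θ_{-n e₀} dμ` under the limit state (torus states are
  translation invariant, so the shifted one-point functions have the same limit).

No definitions are introduced.

References: E. Seiler, LNP 159 (1982) Ch. 2; S. Chatterjee, arXiv:1803.01950 §2;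
K. Osterwalder, E. Seiler, Ann. Phys. 110 (1978) §4.
-/

noncomputable section

open MeasureTheory Filter Topology
open Literature.MathematicalPhysics.QuantumFieldTheory Literature.MathematicalPhysics.QuantumLattice
open Literature.Probability.LatticeModels (Torus.proj)

namespace Summit.QuantumFields.YangMills.Theorems.EquipartitionCriticality.RPProbe

variable {G : Type}

/-! ### Bridge identities: the probe on periodic configurations -/

section Bridge

/-- `proj 0 = 0` for the reduction `ℤ^d → (ℤ/Lℤ)^d`. [folklore] -/
theorem torusProj_zero (L : ℕ) {d : ℕ} :
    Torus.proj L (0 : Literature.Probability.LatticeModels.Site d) = 0 := by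
  funext i
  simp [Torus.proj]

/-- `proj (-v) = -proj v` for the reduction `ℤ^d → (ℤ/Lℤ)^d`. [folklore] -/
theorem torusProj_neg (L : ℕ) {d : ℕ} (v : Literature.Probability.LatticeModels.Site d) :
    Torus.proj L (-v) = -Torus.proj L v := by
  funext i
  simp [Torus.proj]

/-- `proj (n e₀) = n e₀` on the time axis of `(ℤ/Lℤ)⁴`. [folklore] -/
theorem torusProj_single_zero (L : ℕ) (n : ℕ) :
    Torus.proj L (Pi.single (0 : Fin 4) (n : ℤ) : Literature.Probability.LatticeModels.Site 4) =
      (Pi.single (0 : Fin 4) ((n : ℕ) : ZMod L) : Site 4 L) := by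
  funext i
  by_cases hi : i = 0
  · subst hi
    simp [Torus.proj]
  · simp [Torus.proj, hi]

variable [MeasurableSpace G]

/-- The periodic lift intertwines the translations of `ℤ^d` with the torus translations:
`θ_v (Ũ) = (τ_{proj v} U)~` (`toTorusObservable_comp_configShift` at `F = id`). [folklore] -/
theorem configShift_torusLift {d : ℕ} (L : ℕ) (v : Literature.Probability.LatticeModels.Site d)
    (U : GaugeConfig d L G) :
    configShift v (torusLift L U) = torusLift L (torusConfigShift (Torus.proj L v) U) := by
  have h := toTorusObservable_comp_configShift (G := G) L v (id : LGConfig d G → LGConfig d G)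
  exact congrFun h U

variable [Group G]

omit [MeasurableSpace G] in
/-- The `ℤ⁴` site probe read on a periodic configuration is the torus site probe at the origin:
`ψ(Ũ_{p₁₂(0)}) = ψ(U_{p₁₂(0)})` (`plaquette_torusLift`). [folklore] -/
theorem probe_torusLift (ψ : G → ℝ) (L : ℕ) (U : GaugeConfig 4 L G) :
    ψ (plaquetteHolonomyZd (torusLift L U) 0 1 2) = ψ (plaquetteHolonomy U 0 1 2) := by
  have h := plaquette_torusLift L U 0 1 2
  rw [torusProj_zero] at h
  exact congrArg ψ h

/-- The translated `ℤ⁴` site probe read on a periodic configuration is the torus site probe at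
the projected site: `ψ((θ_{-v}Ũ)_{p₁₂(0)}) = ψ(U_{p₁₂(proj v)})`. [folklore] -/
theorem probe_configShift_torusLift (ψ : G → ℝ) (L : ℕ)
    (v : Literature.Probability.LatticeModels.Site 4) (U : GaugeConfig 4 L G) :
    ψ (plaquetteHolonomyZd (configShift (-v) (torusLift L U)) 0 1 2) =
      ψ (plaquetteHolonomy U (Torus.proj L v) 1 2) := by
  rw [configShift_torusLift, torusProj_neg]
  have h := plaquette_torusLift L (torusConfigShift (-Torus.proj L v) U) 0 1 2
  rw [plaquetteHolonomy_torusConfigShift, torusProj_zero, zero_sub, neg_neg] at h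
  exact congrArg ψ h

variable [TopologicalSpace G] [IsTopologicalGroup G] [CompactSpace G] [BorelSpace G] {N : ℕ}
  (ρ : G →* Matrix (Fin N) (Fin N) ℂ)

/-- **The torus connected correlation of the probe is the time-axis two-point function of the
torus site probe**: for `P(V) = ψ(V_{p₁₂(0)})` on `ℤ⁴` and the torus of side `2S+1`,
`latticeConnectedCorr ρ β (2S+1) P P n = ⟨q₀ q_{n e₀}⟩_β - ⟨q₀⟩_β²` with
`q_x(U) = ψ(U_{p₁₂(x)})` (Osterwalder–Seiler 1978 §2, time correlations on the periodic
lattice). [folklore] -/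
theorem latticeConnectedCorr_probe (β : ℝ) (ψ : G → ℝ) (S n : ℕ) :
    latticeConnectedCorr ρ β (2 * S + 1) (fun V => ψ (plaquetteHolonomyZd V 0 1 2))
        (fun V => ψ (plaquetteHolonomyZd V 0 1 2)) n =
      (∫ U, ψ (plaquetteHolonomy U 0 1 2) *
          ψ (plaquetteHolonomy U (Pi.single 0 ((n : ℕ) : ZMod (2 * S + 1))) 1 2)
          ∂(wilsonMeasure (d := 4) (L := 2 * S + 1) ρ β)) -
        (∫ U, ψ (plaquetteHolonomy U 0 1 2) ∂(wilsonMeasure (d := 4) (L := 2 * S + 1) ρ β)) *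
          (∫ U, ψ (plaquetteHolonomy U 0 1 2) ∂(wilsonMeasure (d := 4) (L := 2 * S + 1) ρ β)) := by
  simp only [latticeConnectedCorr, probe_torusLift, probe_configShift_torusLift,
    torusProj_single_zero]

end Bridge

/-! ### Limit states along odd tori -/

section Limit

variable [Group G] [TopologicalSpace G] [IsTopologicalGroup G] [CompactSpace G]
  [MeasurableSpace G] [BorelSpace G] {N : ℕ} (ρ : G →* Matrix (Fin N) (Fin N) ℂ)

/-- **Infinite-volume limit points along odd tori exist.** For a continuous representation `ρ`
of the compact second-countable Hausdorff group `G` and every `β`, the torus Wilson states on the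
odd tori `(ℤ/(2S+1)ℤ)^d` (transported to `G^{edges(ℤ^d)}`) have a subsequence `S_k` converging on
all bounded continuous cylinder observables to a probability measure `μ`, which therefore lies in
`infiniteVolumeLimitPoints ρ β` (sizes `L_k + 1 = 2 S_k + 1`): compactness and metrisability of
`ProbabilityMeasure (G^{edges})` (Riesz–Markov / Prokhorov; Seiler LNP 159 Ch. 2; Chatterjee
arXiv:1803.01950 §2), exactly as in the tree's `infiniteVolumeLimitPoints_nonempty_holds`.
[cite: arXiv180301950, §2 (infinite-volume Gibbs measures by compactness)] -/
theorem exists_oddTorusLimit [T2Space G] [SecondCountableTopology G] (hρ : Continuous ρ)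
    (β : ℝ) {d : ℕ} :
    ∃ μ : Measure (LGConfig d G), IsProbabilityMeasure μ ∧ ∃ φ : ℕ → ℕ, StrictMono φ ∧
      (∀ (F : LGConfig d G → ℝ) (S : Finset (Literature.MathematicalPhysics.QuantumLattice.ZdEdge d)), IsCylinder F S → Continuous F →
        (∃ C, ∀ U, |F U| ≤ C) →
        Tendsto (fun k : ℕ =>
          wilsonExpectation (L := 2 * φ k + 1) ρ β (toTorusObservable (2 * φ k + 1) F))
          atTop (𝓝 (∫ U, F U ∂μ))) ∧
      μ ∈ infiniteVolumeLimitPoints (d := d) ρ β := by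
  haveI := fun L : ℕ => isProbabilityMeasure_torusState (d := d) (L := 2 * L + 1) ρ hρ β
  let P : ℕ → ProbabilityMeasure (LGConfig d G) := fun L =>
    ⟨torusState ρ β (2 * L + 1), inferInstance⟩
  obtain ⟨μ, -, φ, hφ, hlim⟩ :=
    (isCompact_univ (X := ProbabilityMeasure (LGConfig d G))).tendsto_subseq
      fun n => Set.mem_univ (P n)
  have hconv : ∀ (F : LGConfig d G → ℝ) (S : Finset (Literature.MathematicalPhysics.QuantumLattice.ZdEdge d)), IsCylinder F S →
      Continuous F → (∃ C, ∀ U, |F U| ≤ C) →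
      Tendsto (fun k : ℕ =>
        wilsonExpectation (L := 2 * φ k + 1) ρ β (toTorusObservable (2 * φ k + 1) F))
        atTop (𝓝 (∫ U, F U ∂(μ : Measure (LGConfig d G)))) := by
    intro F S _ hFc hFb
    obtain ⟨C, hC⟩ := hFb
    let Fb : BoundedContinuousFunction (LGConfig d G) ℝ :=
      BoundedContinuousFunction.ofNormedAddCommGroup F hFc C
        (fun U => by simpa [Real.norm_eq_abs] using hC U)
    have hE : (fun k : ℕ =>
        wilsonExpectation (L := 2 * φ k + 1) ρ β (toTorusObservable (2 * φ k + 1) F)) =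
        fun k => ∫ U, Fb U ∂(P (φ k) : Measure (LGConfig d G)) :=
      funext fun k => wilsonExpectation_toTorusObservable ρ β (2 * φ k + 1) hFc.measurable
    have key : Tendsto (fun k : ℕ => ∫ U, Fb U ∂(P (φ k) : Measure (LGConfig d G))) atTop
        (𝓝 (∫ U, Fb U ∂(μ : Measure (LGConfig d G)))) :=
      (ProbabilityMeasure.tendsto_iff_forall_integral_tendsto.1 hlim) Fb
    rw [hE]
    exact key
  refine ⟨(μ : Measure (LGConfig d G)), inferInstance, φ, hφ, hconv, fun k => 2 * φ k,
    fun a b hab => ?_, inferInstance, fun F S hS hFc hFb => hconv F S hS hFc hFb⟩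
  have := hφ hab
  dsimp only
  omega

/-! ### The probe as a cylinder observable on `ℤ⁴` -/

omit [TopologicalSpace G] [IsTopologicalGroup G] [CompactSpace G] [MeasurableSpace G]
  [BorelSpace G] in
/-- The site probe `P(V) = ψ(V_{p₁₂(0)})` is a cylinder observable supported on the four links of
the origin plaquette in the `(1,2)` plane. [folklore] -/
theorem isCylinder_probe (ψ : G → ℝ) :
    IsCylinder (fun V : LGConfig 4 G => ψ (plaquetteHolonomyZd V 0 1 2))
      (originPlaquetteSupport 1 2) := by
  intro U V h
  simp only [plaquetteHolonomyZd]
  have h1 := h (((0 : Literature.Probability.LatticeModels.Site 4)), (1 : Fin 4))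
    (by simp [originPlaquetteSupport])
  have h2 := h ((0 : Literature.Probability.LatticeModels.Site 4) + Pi.single 1 1, (2 : Fin 4))
    (by simp [originPlaquetteSupport])
  have h3 := h ((0 : Literature.Probability.LatticeModels.Site 4) + Pi.single 2 1, (1 : Fin 4))
    (by simp [originPlaquetteSupport])
  have h4 := h (((0 : Literature.Probability.LatticeModels.Site 4)), (2 : Fin 4))
    (by simp [originPlaquetteSupport])
  rw [h1, h2, h3, h4]

omit [CompactSpace G] [MeasurableSpace G] [BorelSpace G] in
/-- The site probe is continuous on `G^{edges(ℤ⁴)}` for continuous `ψ`. [folklore] -/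
theorem continuous_probe {ψ : G → ℝ} (hψ : Continuous ψ) :
    Continuous fun V : LGConfig 4 G => ψ (plaquetteHolonomyZd V 0 1 2) := by
  refine hψ.comp ?_
  unfold plaquetteHolonomyZd
  fun_prop

/-- **Convergence of the torus connected correlations of the probe along an odd-torus limit.**
If the torus Wilson states of sides `2 S_k + 1` converge on bounded continuous cylinder
observables to the probability measure `μ`, then for the site probe `P(V) = ψ(V_{p₁₂(0)})`
(`ψ` continuous and bounded) and every time separation `n`,
`latticeConnectedCorr ρ β (2S_k+1) P P n → ∫ P · P∘θ_{-n e₀} dμ - ∫ P dμ · ∫ P∘θ_{-n e₀} dμ`: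
the three torus expectations converge, and the shifted one-point function has the same torus
expectations as the unshifted one (translation invariance of the torus states,
`wilsonExpectation_comp_torusConfigShift`) hence the same limit (Osterwalder–Seiler 1978 §4;
Seiler LNP 159 Ch. 2). [folklore] -/
theorem tendsto_latticeConnectedCorr_probe [SecondCountableTopology G] (β : ℝ)
    {ψ : G → ℝ} (hψ : Continuous ψ) (hψb : ∃ C : ℝ, ∀ g, |ψ g| ≤ C)
    {μ : Measure (LGConfig 4 G)} {φ : ℕ → ℕ}
    (hconv : ∀ (F : LGConfig 4 G → ℝ) (S : Finset (Literature.MathematicalPhysics.QuantumLattice.ZdEdge 4)), IsCylinder F S → Continuous F →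
      (∃ C, ∀ U, |F U| ≤ C) →
      Tendsto (fun k : ℕ =>
        wilsonExpectation (L := 2 * φ k + 1) ρ β (toTorusObservable (2 * φ k + 1) F))
        atTop (𝓝 (∫ U, F U ∂μ)))
    (n : ℕ) :
    Tendsto (fun k : ℕ => latticeConnectedCorr ρ β (2 * φ k + 1)
        (fun V => ψ (plaquetteHolonomyZd V 0 1 2)) (fun V => ψ (plaquetteHolonomyZd V 0 1 2)) n)
      atTop
      (𝓝 ((∫ U, ψ (plaquetteHolonomyZd U 0 1 2) *
            ψ (plaquetteHolonomyZd (configShift (-(Pi.single 0 (n : ℤ))) U) 0 1 2) ∂μ) -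
          (∫ U, ψ (plaquetteHolonomyZd U 0 1 2) ∂μ) *
            (∫ U, ψ (plaquetteHolonomyZd (configShift (-(Pi.single 0 (n : ℤ))) U) 0 1 2) ∂μ))) := by
  obtain ⟨C, hC⟩ := hψb
  set P : LGConfig 4 G → ℝ := fun V => ψ (plaquetteHolonomyZd V 0 1 2) with hP
  set v : Literature.Probability.LatticeModels.Site 4 := Pi.single 0 (n : ℤ) with hv
  have hPcyl : IsCylinder P (originPlaquetteSupport 1 2) := isCylinder_probe ψ
  have hPc : Continuous P := continuous_probe hψ
  have hPb : ∃ C, ∀ U, |P U| ≤ C := ⟨C, fun U => hC _⟩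
  have hPs_cyl : IsCylinder (P ∘ configShift (-v)) _ := IsCylinder.comp_configShift hPcyl (-v)
  have hPs_c : Continuous (P ∘ configShift (-v)) := hPc.comp (continuous_configShift (-v))
  have hPs_b : ∃ C, ∀ U, |(P ∘ configShift (-v)) U| ≤ C := ⟨C, fun U => hC _⟩
  -- the three convergences
  have t1 := hconv (fun V => P V * (P ∘ configShift (-v)) V) _ (IsCylinder.mul hPcyl hPs_cyl)
    (hPc.mul hPs_c) ⟨C * C, fun U => by
      have h1 : |P U| ≤ C := hC _
      have h2 : |(P ∘ configShift (-v)) U| ≤ C := hC _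
      rw [abs_mul]
      exact mul_le_mul h1 h2 (abs_nonneg _) ((abs_nonneg _).trans h1)⟩
  have t2 := hconv P _ hPcyl hPc hPb
  have t3 := hconv _ _ hPs_cyl hPs_c hPs_b
  -- the shifted one-point functions agree with the unshifted ones on every torus
  have hE : ∀ k : ℕ, wilsonExpectation (L := 2 * φ k + 1) ρ β
      (toTorusObservable (2 * φ k + 1) (P ∘ configShift (-v))) =
      wilsonExpectation (L := 2 * φ k + 1) ρ β (toTorusObservable (2 * φ k + 1) P) := fun k => by
    rw [toTorusObservable_comp_configShift, wilsonExpectation_comp_torusConfigShift]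
  simp only [hE] at t3
  have hmean : ∫ U, (P ∘ configShift (-v)) U ∂μ = ∫ U, P U ∂μ := tendsto_nhds_unique t3 t2
  have hmean' : ∫ U, ψ (plaquetteHolonomyZd (configShift (-v) U) 0 1 2) ∂μ = ∫ U, P U ∂μ := hmean
  rw [hmean']
  have hLCC : ∀ k : ℕ, latticeConnectedCorr ρ β (2 * φ k + 1) P P n =
      wilsonExpectation (L := 2 * φ k + 1) ρ β
          (toTorusObservable (2 * φ k + 1) fun V => P V * (P ∘ configShift (-v)) V) -
        wilsonExpectation (L := 2 * φ k + 1) ρ β (toTorusObservable (2 * φ k + 1) P) *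
          wilsonExpectation (L := 2 * φ k + 1) ρ β (toTorusObservable (2 * φ k + 1) P) :=
    fun k => rfl
  simp only [hLCC]
  exact t1.sub (t2.mul t2)

end Limit

end Summit.QuantumFields.YangMills.Theorems.EquipartitionCriticality.RPProbe

end
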